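import Mathlib
import HarnessLib

/-!
# Route `ByReductionTypeAtTwo`, crux `MultUpperHalfAtTwo` (item stmt-BirchSwinnertonDyer-19922), the «NEITHER» wall:
# the layer-0 law of the mixed ray class towers (cell memo PROOF-NEITHER ADDENDUM-1 §3, Lemma L0), kernel version

HONEST FRAMING (cell `bsd-2adic`, run/shared/lean/pub/bsd-2adic/, seat `bsd-2adic-mult` GEN 15, D-0036 / D-0054): elementary
number theory only; nothing about BSD is proved by this file. Context: for a «neither» curve `E/ℚ` (rational `2`-torsion point neither
ramified at `2` nor odd; Greenberg, LNM 1716, Props. 5.13/5.14 are silent) with `2`-division field `ℚ(√d)`, `d ≡ 1 (mod 8)`, the cell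
memo `mult/PROOF-NEITHER.md` (Theorem A) translates `μ(X(E/ℚ_∞)) = 0` into the boundedness of the `2`-rank of a MIXED ray class tower
of `ℚ_n(√d)`, and ADDENDUM-1 (Theorem A1) writes that `2`-rank as `1 + k_n + (class-group part)`, `k_n` = the number of independent
units of `ℚ_n(√d)` that are squares at ONE dyadic prime and positive on ONE half of the real places. At layer `0` the only candidate
unit is the fundamental unit `ε = x + y√d`; when `N ε = −1`, i.e. `x² − d y² = −1`, the theorems below say `4 ∣ x`, `y ≡ 1 (mod 4)`
(every prime factor of `y` divides `x² + 1`, so is `≡ 1 (mod 4)`), hence `x + y s ≡ 1 (mod 4)` and `x − y s ≡ 3 (mod 4)` for every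
`s ≡ 1 (mod 4)` — in particular for the `2`-adic square root `s₀ ≡ 1 (mod 4)` of `d`: the unit positive at the real place `√d > 0` is
`≡ 1 (mod 4)` exactly at the dyadic prime MATCHED with it (ADDENDUM-1 Lemma L0: the «crossed» tower never gets a kernel unit at layer
`0` when `N ε_d = −1`). References: cell memo HOME/mult/PROOF-NEITHER.md (GEN 14) + PROOF-NEITHER-ADDENDUM-1.md (GEN 15) §3;
R. Greenberg, LNM 1716 (1999) §5.
-/

set_option autoImplicit false
-- the Theorems namespace of this sub repeats the summit name by design (D-0017 nested layout: Summit.<S>.<Sub>)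
set_option linter.dupNamespace false

namespace Summit.BirchSwinnertonDyer.BirchSwinnertonDyer.Theorems.MultNeither

/-- An odd prime dividing `x² + 1` is `≡ 1 (mod 4)` (first supplement to quadratic reciprocity). [folklore] -/
theorem prime_mod_four_eq_one_of_dvd_sq_add_one {p : ℕ} (hp : p.Prime) (hp2 : p ≠ 2) {x : ℤ}
    (h : (p : ℤ) ∣ x ^ 2 + 1) : p % 4 = 1 := by
  haveI : Fact p.Prime := ⟨hp⟩
  have hx : ((x : ZMod p)) ^ 2 = -1 := by
    have h0 : ((x ^ 2 + 1 : ℤ) : ZMod p) = 0 := by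
      rw [ZMod.intCast_zmod_eq_zero_iff_dvd]
      exact h
    push_cast at h0
    linear_combination h0
  have h4 : p % 4 ≠ 3 := ZMod.mod_four_ne_three_of_sq_eq_neg_one hx
  rcases hp.eq_two_or_odd with h2 | hodd
  · exact absurd h2 hp2
  · omega

/-- An odd natural number dividing `x² + 1` is `≡ 1 (mod 4)`: all its prime factors are. [folklore] -/
theorem mod_four_eq_one_of_odd_of_dvd_sq_add_one {x : ℤ} :
    ∀ n : ℕ, n % 2 = 1 → (n : ℤ) ∣ x ^ 2 + 1 → n % 4 = 1 := by
  intro n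
  induction n using Nat.strong_induction_on with
  | _ n ih =>
    intro hodd hdvd
    by_cases hn1 : n = 1
    · subst hn1; rfl
    · have hn2 : 2 ≤ n := by omega
      have hpp : n.minFac.Prime := Nat.minFac_prime hn1
      obtain ⟨m, hm⟩ := Nat.minFac_dvd n
      have hp2 : n.minFac ≠ 2 := by
        intro h2
        have : 2 ∣ n := h2 ▸ Nat.minFac_dvd n
        omega
      have hpdvd : ((n.minFac : ℕ) : ℤ) ∣ x ^ 2 + 1 :=
        dvd_trans (Int.natCast_dvd_natCast.mpr (Nat.minFac_dvd n)) hdvd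
      have hp1 : n.minFac % 4 = 1 := prime_mod_four_eq_one_of_dvd_sq_add_one hpp hp2 hpdvd
      have hmpos : 0 < m := by
        rcases Nat.eq_zero_or_pos m with h0 | h0
        · rw [h0, mul_zero] at hm; omega
        · exact h0
      have hmlt : m < n := by
        rw [hm]
        exact lt_mul_of_one_lt_left hmpos hpp.one_lt
      have hmdvd_n : m ∣ n := ⟨n.minFac, hm.trans (mul_comm _ _)⟩
      have hmodd : m % 2 = 1 := by
        rcases Nat.even_or_odd m with he | ho
        · exfalso
          have : 2 ∣ n := dvd_trans he.two_dvd hmdvd_n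
          omega
        · exact Nat.odd_iff.mp ho
      have hmdvd : (m : ℤ) ∣ x ^ 2 + 1 := dvd_trans (Int.natCast_dvd_natCast.mpr hmdvd_n) hdvd
      have hm1 : m % 4 = 1 := ih m hmlt hmodd hmdvd
      calc n % 4 = (n.minFac * m) % 4 := congrArg (· % 4) hm
        _ = (n.minFac % 4) * (m % 4) % 4 := Nat.mul_mod _ _ _
        _ = 1 := by rw [hp1, hm1]

/-- **Negative Pell equation modulo 8** (`d ≡ 1 (mod 8)`): from `x² − d y² = −1`, `y` is odd and `4 ∣ x`. [folklore] -/
theorem negPell_four_dvd_x_and_odd_y {x y d : ℤ} (hd : d % 8 = 1) (h : x ^ 2 - d * y ^ 2 = -1) :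
    x % 4 = 0 ∧ y % 2 = 1 := by
  -- squares modulo 8, with the residue information kept linear for `omega`
  have hx : ((x % 8 = 0 ∨ x % 8 = 4) ∧ x ^ 2 % 8 = 0) ∨ ((x % 8 = 2 ∨ x % 8 = 6) ∧ x ^ 2 % 8 = 4) ∨
      (x % 2 = 1 ∧ x ^ 2 % 8 = 1) := by
    have h8 : x % 8 = 0 ∨ x % 8 = 1 ∨ x % 8 = 2 ∨ x % 8 = 3 ∨ x % 8 = 4 ∨ x % 8 = 5 ∨ x % 8 = 6 ∨ x % 8 = 7 := by
      omega
    have hsq : x ^ 2 % 8 = (x % 8) * (x % 8) % 8 := by rw [pow_two, Int.mul_emod]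
    rcases h8 with h0 | h0 | h0 | h0 | h0 | h0 | h0 | h0 <;> (rw [h0] at hsq; norm_num at hsq; omega)
  have hy : ((y % 8 = 0 ∨ y % 8 = 4) ∧ y ^ 2 % 8 = 0) ∨ ((y % 8 = 2 ∨ y % 8 = 6) ∧ y ^ 2 % 8 = 4) ∨
      (y % 2 = 1 ∧ y ^ 2 % 8 = 1) := by
    have h8 : y % 8 = 0 ∨ y % 8 = 1 ∨ y % 8 = 2 ∨ y % 8 = 3 ∨ y % 8 = 4 ∨ y % 8 = 5 ∨ y % 8 = 6 ∨ y % 8 = 7 := by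
      omega
    have hsq : y ^ 2 % 8 = (y % 8) * (y % 8) % 8 := by rw [pow_two, Int.mul_emod]
    rcases h8 with h0 | h0 | h0 | h0 | h0 | h0 | h0 | h0 <;> (rw [h0] at hsq; norm_num at hsq; omega)
  have hdy : (d * y ^ 2) % 8 = y ^ 2 % 8 := by
    rw [Int.mul_emod, hd, one_mul, Int.emod_emod_of_dvd _ (by norm_num : (8:ℤ) ∣ 8)]
  have key : (x ^ 2 + 1) % 8 = y ^ 2 % 8 := by
    have : x ^ 2 + 1 = d * y ^ 2 := by linear_combination h
    rw [this, hdy]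
  omega

/-- **ADDENDUM-1, Lemma L0 (kernel form).** If `x² − d y² = −1` with `d ≡ 1 (mod 8)` and `y > 0`, then `y ≡ 1 (mod 4)` and
`4 ∣ x`; consequently for every `s ≡ 1 (mod 4)` (e.g. a `2`-adic square root of `d` reduced mod `4`), `x + y s ≡ 1 (mod 4)` and
`x − y s ≡ 3 (mod 4)`: the fundamental unit of norm `−1` of `ℚ(√d)`, which is positive at the real place `√d > 0`, is `≡ 1 (mod 4)`
exactly at the dyadic prime where `√d ≡ 1 (mod 4)` («matched»), never at the other («crossed»).
[cite: GreenbergLNM1716, §5 (shape: the predicates ramified/odd at 2)] [folklore] -/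
theorem negPell_y_mod_four {x y d : ℤ} (hd : d % 8 = 1) (h : x ^ 2 - d * y ^ 2 = -1) (hy : 0 < y) :
    y % 4 = 1 ∧ x % 4 = 0 := by
  obtain ⟨hx4, hyodd⟩ := negPell_four_dvd_x_and_odd_y hd h
  refine ⟨?_, hx4⟩
  -- y divides x² + 1 = d y²
  have hdvd : y ∣ x ^ 2 + 1 := ⟨d * y, by linear_combination h⟩
  lift y to ℕ using hy.le with n hn
  have hnodd : n % 2 = 1 := by exact_mod_cast hyodd
  have := mod_four_eq_one_of_odd_of_dvd_sq_add_one n hnodd hdvd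
  exact_mod_cast this

/-- Lemma L0, local form at the two dyadic primes: with `s ≡ 1 (mod 4)`, `x + y s ≡ 1` and `x − y s ≡ 3 (mod 4)`. [folklore] -/
theorem negPell_unit_mod_four {x y d s : ℤ} (hd : d % 8 = 1) (h : x ^ 2 - d * y ^ 2 = -1) (hy : 0 < y)
    (hs : s % 4 = 1) : (x + y * s) % 4 = 1 ∧ (x - y * s) % 4 = 3 := by
  obtain ⟨hy4, hx4⟩ := negPell_y_mod_four hd h hy
  constructor
  · rw [Int.add_emod, Int.mul_emod, hy4, hs]; omega
  · rw [Int.sub_emod, Int.mul_emod, hy4, hs]; omega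

end Summit.BirchSwinnertonDyer.BirchSwinnertonDyer.Theorems.MultNeither
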